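import Literature.NumberTheory.Automorphic.HarrisLanTaylorThorneThm713Proofs
import Literature.NumberTheory.Automorphic.ReciprocityGLnUniquenessProofs
import Literature.NumberTheory.Automorphic.SatakeParamNeZeroProofs
import Literature.NumberTheory.Automorphic.AutomorphicRepsGLSatakeFlathProofs
import HarnessLib

/-!
# lang.S27 (`exists_galoisRep_of_regularAlgebraic`): the conditional results on their named leaves

Topic `Literature/NumberTheory/Automorphic`.  A *proofs* file (theorems only) closing the
bookkeeping of the decomposition of the named fact
`Literature.NumberTheory.Automorphic.exists_galoisRep_of_regularAlgebraic` (**lang.S27**,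
`ReciprocityGLn`; Harris–Lan–Taylor–Thorne 2016, Thm. A with Varma 2024, Cor. 9.3) carried out in
`ReciprocityGLnProofs` (top layer: `HarrisLanTaylorThorne2016.theoremA_existence`,
`theoremA_uniqueness`, `Varma2024.corollary93_unramified`, assembly
`exists_galoisRep_of_regularAlgebraic_of`), `ReciprocityGLnUniquenessProofs` (the uniqueness
clause of Thm. A, proved), `HarrisLanTaylorThorneCor627` / `HarrisLanTaylorThorneThm713` /
`HarrisLanTaylorThorneThm713Proofs` (Thm. 7.13 proved from Prop. 7.12 and Cor. 6.27) and
`GaloisRepresentations/TwistedSumDecomposition` (Prop. 7.12).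

Two hypotheses threaded through those conditional theorems are named facts of the tree that are
**discharged**, for every automorphic representation, in sibling proofs files not imported there:

* Flath's "`π` is unramified at all but finitely many places", `π.hasSatakeParamAt_cofinite` —
  `AutomorphicRepData.hasSatakeParamAt_cofinite_holds` (`AutomorphicRepsGLSatakeFlathProofs`);
* "Satake parameters of automorphic representations are non-zero", `hasSatakeParamAt_ne_zero` —
  `hasSatakeParamAt_ne_zero_holds` (`SatakeParamNeZeroProofs`).

Feeding them in leaves each conditional result depending on exactly its *printed* named leaves,
which is the honest census of the decomposition (every one of these leaves is a theory absent from
Mathlib — rigid cohomology of the ordinary locus of the `U(n,n)` Shimura variety, linear algebraic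
groups over `ℚ̄_p`, the Chebotarev density theorem):

* `HarrisLanTaylorThorne2016.theoremA_uniqueness_of_chebotarev` — the uniqueness clause of Thm. A
  (p. 3) from `chebotarev_artinRep` **alone**;
* `HarrisLanTaylorThorne2016.theorem713_of_leaves` — Thm. 7.13 (p. 232; `n > 1`, both printed
  alternatives on `q`) from exactly `prop712Hausdorff` (HLTT Prop. 7.12 in its corrected form —
  Hausdorff `k`; the literal transcription `prop712` is refuted, `not_prop712`),
  `corollary627_splitOrUnramified` (HLTT Cor. 6.27) and `chebotarev_artinRep`;
* `nonempty_equiv_of_forall_isGaloisCompatibleAt` — **the representation of lang.S27 is unique up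
  to isomorphism** (granted Chebotarev): two continuous semisimple `r, r' : Γ_K → GL_n(ℚ̄_ℓ)` with
  the compatibility of lang.S27 at every `v ∤ ℓ` have isomorphic underlying continuous
  representations — the form in which users of the named fact `(h : exists_galoisRep_of_regularAlgebraic)`
  need uniqueness (such `r` are in particular HLTT-compatible, `isCompatible_of_forall_not_mem`).

Status of lang.S27 after this file (fact-owner's census, gen 1): it is exactly the unramified-place
content of Varma's Cor. 9.3 (arXiv Cor. 10.3), which presupposes HLTT's Thm. A; in Lean it follows
(`exists_galoisRep_of_regularAlgebraic_of`) from the named facts `theoremA_existence` and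
`corollary93_unramified`; Thm. A's existence half is Cor. 7.14, printed as "Thm. 7.13 + lemma 1 of
Sorensen's *A patching lemma*" (base change to `E·ℚ(√-D)` and patching — not built in the tree),
and Thm. 7.13 is `theorem713_of_leaves` below.  No leaf is within reach of a proof; the fact stays
a named fact with this trust base.

## References

* M. Harris, K.-W. Lan, R. Taylor, J. Thorne, *On the rigid cohomology of certain Shimura
  varieties*, Res. Math. Sci. 3:37 (2016): Thm. A (p. 3), Cor. 6.27 (p. 225), Prop. 7.12,
  Thm. 7.13, Cor. 7.14 (p. 232). [HarrisLanTaylorThorneRMS2016]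
* I. Varma, *Local-global compatibility for regular algebraic cuspidal automorphic
  representations when `ℓ ≠ p`*, Forum Math. Sigma 12 (2024) e21, Cor. 9.3 (= arXiv:1411.2520,
  Cor. 10.3). [VarmaFMS2024]
* D. Flath, *Decomposition of representations into tensor products*, Corvallis (1979), Thm. 3.
  [Flath1979]
-/

noncomputable section

open scoped MatrixGroups Matrix Classical Polynomial NumberField
open NumberField IsDedekindDomain Field Polynomial Literature.NumberTheory.Automorphic

namespace Literature.NumberTheory.Automorphic

namespace HarrisLanTaylorThorne2016

/-- **Harris–Lan–Taylor–Thorne 2016, Thm. A — uniqueness, from Chebotarev alone.**  Two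
continuous semisimple `r, r' : Γ_K → GL_n(ℚ̄_ℓ)` with HLTT's characterising property
(`IsCompatible π ι ·`) have isomorphic underlying continuous representations, granted the
Chebotarev density theorem in the form `chebotarev_artinRep`: this is `theoremA_uniqueness_of`
(Frobenius density + Brauer–Nesbitt, `ReciprocityGLnUniquenessProofs`) with its second hypothesis
— Flath's "automorphic representations are unramified almost everywhere" — discharged by
`AutomorphicRepData.hasSatakeParamAt_cofinite_holds`.
[cite: HarrisLanTaylorThorneRMS2016, Thm. A (p. 3), uniqueness clause] -/
theorem theoremA_uniqueness_of_chebotarev (hC : chebotarev_artinRep) : theoremA_uniqueness :=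
  theoremA_uniqueness_of hC fun π ↦ π.hasSatakeParamAt_cofinite_holds

/-- **Harris–Lan–Taylor–Thorne 2016, Thm. 7.13 (`n > 1`, both printed alternatives on `q`) from
exactly its printed named leaves**: Prop. 7.12 (`prop712Hausdorff`, the group theory, in its
corrected form — Hausdorff `k`, which is what HLTT's proof proves and what Thm. 7.13 applies with
`k = ℚ̄_p`; the literal `prop712` is refuted, `not_prop712`), Cor. 6.27
(`corollary627_splitOrUnramified`, the `2n`-dimensional `R_{p,ı}(π, N)` from the rigid cohomology
of the ordinary locus) and Chebotarev (`chebotarev_artinRep`, through the proved density of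
Frobenius elements).  Let `K` be a CM field, `F₀ ⊆ K` an imaginary quadratic subfield in which the
prime `p` splits, `n > 1`, `π` a cuspidal automorphic representation of `GL_n(𝔸_K)` with `π_∞`
regular algebraic, `ı : ℚ̄_p ≃ ℂ`.  Then there is a continuous semisimple
`r : Γ_K → GL_n(ℚ̄_p)` such that for every rational prime `q ≠ p` which either splits in `F₀` or
is unramified in `K`, above which `π` is unramified, and every `v ∣ q`, `r` is unramified at `v`
and every arithmetic Frobenius at `v` has characteristic polynomial
`arithFrobPolyOfSatake ı q_v n α` for the Satake parameter `α` of `π_v` (`IsGaloisCompatibleAt`).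
This is `theorem713_of` (`HarrisLanTaylorThorneThm713Proofs`) with its hypotheses
`hasSatakeParamAt_ne_zero` and `π.hasSatakeParamAt_cofinite` discharged
(`hasSatakeParamAt_ne_zero_holds`, `AutomorphicRepData.hasSatakeParamAt_cofinite_holds`).
The case `n = 1` ("well known", class field theory) is not treated, as in `theorem713_of`.
[cite: HarrisLanTaylorThorneRMS2016, Thm. 7.13 and its proof (p. 232)] -/
theorem theorem713_of_leaves
    (h712 : Literature.NumberTheory.GaloisRepresentations.HarrisLanTaylorThorne2016.prop712Hausdorff)
    (h627 : corollary627_splitOrUnramified) (hC : Automorphic.chebotarev_artinRep)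
    {n : ℕ} {K : Type} [Field K] [NumberField K] (hcpt : isCompact_glFiniteIntegralLevel n K)
    (p : ℕ) [Fact p.Prime] (hn : 1 < n) (hCM : IsCMField K)
    (F₀ : IntermediateField ℚ K) (hF₀ : Module.finrank ℚ F₀ = 2 ∧ IsTotallyComplex F₀)
    (hF₀p : HasTwoPrimesOver F₀ p)
    (π : CuspidalAutomorphicRepData n K hcpt) (hπ : π.1.IsRegularAlgebraic)
    (ι : PadicAlgCl p ≃+* ℂ) :
    ∃ r : GaloisRepresentations.FramedGaloisRep K (PadicAlgCl p) n, r.toGaloisRep.IsSemisimple ∧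
      ∀ q : ℕ, q.Prime → q ≠ p →
        (HasTwoPrimesOver F₀ q ∨ Algebra.IsUnramifiedIn (𝓞 K) (Ideal.span {(q : ℤ)})) →
        π.1.IsUnramifiedAbove q →
        ∀ v : HeightOneSpectrum (𝓞 K), ((q : ℕ) : 𝓞 K) ∈ v.asIdeal →
          IsGaloisCompatibleAt π.1 ι r v :=
  theorem713_of h712 h627 hC hasSatakeParamAt_ne_zero_holds hcpt p hn hCM F₀ hF₀ hF₀p π hπ
    π.1.hasSatakeParamAt_cofinite_holds ι

end HarrisLanTaylorThorne2016

/-- **The representation of lang.S27 is unique up to isomorphism** (granted Chebotarev,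
`chebotarev_artinRep`).  Let `K` be totally real or CM, `π` a regular algebraic cuspidal
automorphic representation of `GL_n(𝔸_K)`, `ℓ` a prime, `ι : ℚ̄_ℓ ≃+* ℂ`.  If `r, r' : Γ_K →
GL_n(ℚ̄_ℓ)` are continuous semisimple and both have the compatibility asserted by
`exists_galoisRep_of_regularAlgebraic` — at every finite `v ∤ ℓ`, for every Satake parameter `α`
of `π` at `v`, unramified with arithmetic-Frobenius characteristic polynomial
`arithFrobPolyOfSatake ι q_v n α` (`IsGaloisCompatibleAt`) — then their underlying continuous
representations on `ℚ̄_ℓⁿ` are isomorphic (`ContinuousRep.Equiv`).  Such `r` are HLTT-compatible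
(`HarrisLanTaylorThorne2016.isCompatible_of_forall_not_mem`), so this is the uniqueness clause of
Harris–Lan–Taylor–Thorne's Thm. A (`theoremA_uniqueness_of_chebotarev`: Chebotarev and
Brauer–Nesbitt).  [cite: HarrisLanTaylorThorneRMS2016, Thm. A (p. 3), uniqueness clause] -/
theorem nonempty_equiv_of_forall_isGaloisCompatibleAt (hC : chebotarev_artinRep)
    {n : ℕ} {K : Type} [Field K] [NumberField K] (hcpt : isCompact_glFiniteIntegralLevel n K)
    (hK : IsTotallyReal K ∨ IsCMField K)
    (π : CuspidalAutomorphicRepData n K hcpt) (hπ : π.1.IsRegularAlgebraic) (ℓ : ℕ) [Fact ℓ.Prime]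
    (ι : PadicAlgCl ℓ ≃+* ℂ) (r r' : GaloisRepresentations.FramedGaloisRep K (PadicAlgCl ℓ) n)
    (hr : r.toGaloisRep.IsSemisimple) (hr' : r'.toGaloisRep.IsSemisimple)
    (hc : ∀ v : HeightOneSpectrum (𝓞 K), ((ℓ : ℕ) : 𝓞 K) ∉ v.asIdeal →
      IsGaloisCompatibleAt π.1 ι r v)
    (hc' : ∀ v : HeightOneSpectrum (𝓞 K), ((ℓ : ℕ) : 𝓞 K) ∉ v.asIdeal →
      IsGaloisCompatibleAt π.1 ι r' v) :
    Nonempty (GaloisRepresentations.ContinuousRep.Equiv r.toGaloisRep r'.toGaloisRep) :=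
  HarrisLanTaylorThorne2016.theoremA_uniqueness_of_chebotarev hC hcpt hK π hπ ℓ ι r r' hr hr'
    (HarrisLanTaylorThorne2016.isCompatible_of_forall_not_mem hc)
    (HarrisLanTaylorThorne2016.isCompatible_of_forall_not_mem hc')

end Literature.NumberTheory.Automorphic
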